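import Summits.BirchSwinnertonDyer.BirchSwinnertonDyer.Theorems.ClassRecordThreeCartanSupplyCubicCharacterTables
import HarnessLib

/-!
# The cuspidal row of `GL₂(𝔽_q)` by orthogonality counting, I: induced characters from the non-split torus, the faithful character, the two counts — realform §O.1–§O.3

Lift-only port (cell bsd-stepL, SUMMON key `ghostlift`, director-bsd (837) «(κ2) GHOSTLIFT: GO NOW» 2026-08-31; lift by tam3-p1 g43) of §O.1–§O.3 (source lines 1471–1763, `section Cusprow`) of the crux-ideate workfile
`Summits/BirchSwinnertonDyer/BirchSwinnertonDyer/Cruxes/CartanOnePlaceDegreeLawAtThree/Lines/realform.lean` (lineage `cruxidea-stmt-BirchSwinnertonDyer-24801-1`, generation 29, commit 91f4f181dd15, sha256-16 989f1973431c01d3, 2699 l.; farm rc 0, sorries 5 = its §4 stubs, none of which is lifted; referee FULL BATTERY PASS `VERDICT-REALFORM-G29-g94.md`, §O ≡ generation 28's `Lines/cusprow.lean` §O byte-identical, referee `VERDICT-CUSPROW-G28-g93.md`).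
AUTHORS OF THE BYTES: cruxidea-24801 generation 28 (`cusprow`, §O) — carried verbatim by generation 29 (`realform`). Declarations, statements and proofs below are token-identical to the source; the only edits are the namespace
(`…Cruxes.CartanOnePlaceDegreeLawAtThree.Realform` ↦ `…Theorems.CartanDoubleCoset`, shared with the `ClassRecordThreeCartanSupply*` lift modules), the imports ∕ `open`s ∕
section preamble each module needs, and one-line docstrings added where the source had none. Nothing is re-stated, weakened or re-proved.

CONTENT (finite group theory of `G = GL₂(𝔽_q)`, `q` prime; no curve, no modular form). §O.1 scalars (`exists_eq_scalarGL`, `pow_card_sub_one_of_isScalar`,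
`card_scalar_torus`) and the character of `Ind_{T_η}^G ν` for an ARBITRARY character `ν` of the non-split torus `T_η = torusSubgroup eta` on the scalar ∕ parabolic-or-split ∕
elliptic classes (`torusIndGen_scalar`, `torusIndGen_of_hasRatEigenvalue`, `torusIndGen_torus`, `partner_eq_inv`), plus `ZN` bookkeeping (`upperGL_self_zero`,
`upperUnip_mem_znSub`, `discr_upperGL_self`, `sum_znSub_eq`, `znChar_upperGL`). §O.2 the faithful character `faith : T_η →* ℂˣ` (generator ↦ a chosen primitive `|T_η|`-th
root of unity `rootT`), the family `chi j = faith^j` and orthogonality on `T_η` (`sum_chi_inv`). §O.3 the two orthogonality counts `Σ_j dim Hom_{T_η}(ν_j, W) = dim W`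
(`sum_hom_torus_eq`) and `Σ_j dim Hom_{ZN}(ψ_j, W) = dim W` when the scalars act trivially (`sum_hom_zn_eq`), with `hom_torus_zero_pos` ∕ `hom_zn_zero`.
Consumed by `…CuspRowNormOne` (§O.4–§O.5), `…CuspRowGhost` (§O.6–§O.7) and `…CuspRow` (§P.1).

HONEST: a `--supports stmt-BirchSwinnertonDyer-24801 --as helper` module of PROVED finite-group theory ∕ lattice bookkeeping; it closes NO registered stub and NO leaf of
24801 — the five stubs of registry `Lines/jacquet.lean` rev 10.1 ((JV) · (NCB) · (CV♭) · (DS) ∧ (JLᶜ) · (MO1ᴾ)) stand, the registry is untouched by this module, no count moves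
(1∕12 · 0∕12), nothing about NUM ∕ NUM♮ ∕ 24801 ∕ 32276 ∕ 19109 is proved for any curve; BSD is proved for no curve.
-/

set_option linter.dupNamespace false  -- `Summit.BirchSwinnertonDyer.BirchSwinnertonDyer.…` (summit = problem), as every file of this directory
set_option autoImplicit false

noncomputable section

open scoped Classical MatrixGroups
open Matrix

namespace Summit.BirchSwinnertonDyer.BirchSwinnertonDyer.Theorems.CartanDoubleCoset

open Summit.BirchSwinnertonDyer.BirchSwinnertonDyer.Theorems
open Summit.BirchSwinnertonDyer.BirchSwinnertonDyer.Theorems.CartanDegree (HasRatEigenvalue)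
open Summit.BirchSwinnertonDyer.BirchSwinnertonDyer.Theorems.CartanTorusCubeCut (torusSubgroup mem_torusSubgroup lin linGL
  linGL_coe lin_comm torusSubgroup_isCyclic card_torusSubgroup)
open Summit.BirchSwinnertonDyer.BirchSwinnertonDyer.Theorems.CartanCover (splitGen mem_splitTorus_iff)
open Summit.BirchSwinnertonDyer.BirchSwinnertonDyer.Theorems.CartanCover.Charext.InertHecke (upperUnip lowerUnip coe_upperUnip
  coe_lowerUnip upperUnip_mul upperUnip_zero exists_unip_factorization)
open Summit.BirchSwinnertonDyer.BirchSwinnertonDyer.Theorems.CartanCover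
open Summit.BirchSwinnertonDyer.BirchSwinnertonDyer.Theorems.CartanTorusCubeCut

section Cusprow

open Representation (IntertwiningMap)
open Summit.BirchSwinnertonDyer.BirchSwinnertonDyer.Theorems.CartanTorusCubeCut (G Mat)
open Summit.BirchSwinnertonDyer.BirchSwinnertonDyer.Theorems.CartanSupply.Monomial
open Summit.BirchSwinnertonDyer.BirchSwinnertonDyer.Theorems.CartanSupply.VirtualCharacter (exists_irreducible_of_virtual_normOne
  sum_char_mul_char_inv)

variable {q : ℕ} [Fact q.Prime]

/-! ### §O.1 Scalars, and the character of `Ind_{T_η}^G ν` for an ARBITRARY character `ν` of the non-split torus -/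

/-- a scalar invertible matrix is `scalarGL a`. -/
theorem exists_eq_scalarGL {g : G q} (hs : CartanDegree.IsScalarMat (g : Mat q)) : ∃ a : (ZMod q)ˣ, g = Charext.scalarGL a := by
  obtain ⟨c, hc⟩ := (PS.isScalarMat_iff_eq_smul_one (g : Mat q)).1 hs
  have hc0 : c ≠ 0 := by
    intro h0
    apply Matrix.GeneralLinearGroup.det_ne_zero g
    rw [hc, h0, zero_smul, Matrix.det_zero]
  refine ⟨Units.mk0 c hc0, Units.ext ?_⟩
  rw [hc, Charext.coe_scalarGL]; rfl

/-- a scalar element satisfies `g^{q−1} = 1`. -/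
theorem pow_card_sub_one_of_isScalar {g : G q} (hs : CartanDegree.IsScalarMat (g : Mat q)) : g ^ (q - 1) = 1 := by
  obtain ⟨a, rfl⟩ := exists_eq_scalarGL hs
  exact Charext.scalarGL_pow_card_sub_one a

/-- the scalar elements of `T_η` number `q − 1`. -/
theorem card_scalar_torus {eta : Mat q} (hη : ¬ HasRatEigenvalue eta) :
    (Finset.univ.filter fun t : torusSubgroup eta => CartanDegree.IsScalarMat ((t : G q) : Mat q)).card = q - 1 := by
  rw [← card_scalar_nonsplitTorus hη]
  refine Finset.card_bij (fun t _ => (t : G q)) (fun t ht => ?_) (fun a _ b _ h => Subtype.ext h) (fun g hg => ?_)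
  · exact Finset.mem_filter.2 ⟨mem_nonsplitTorus_iff.2 t.2, (Finset.mem_filter.1 ht).2⟩
  · obtain ⟨hgT, hs⟩ := Finset.mem_filter.1 hg
    exact ⟨⟨g, mem_nonsplitTorus_iff.1 hgT⟩, Finset.mem_filter.2 ⟨Finset.mem_univ _, hs⟩, rfl⟩

variable {eta : Mat q}

/-- **SCALAR class**: `χ_{Ind ν}(z) = q(q−1)·ν(z)`. -/
theorem torusIndGen_scalar (hη : ¬ HasRatEigenvalue eta) (θ : torusSubgroup eta →* ℂ) {g : G q} (hs : CartanDegree.IsScalarMat (g : Mat q)) :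
    (monRep (torusSubgroup eta) θ).character g = (q : ℂ) * ((q : ℂ) - 1) * wt (torusSubgroup eta) θ g := by
  have key := frobenius_GL (torusSubgroup eta) θ g
  have hC : (Finset.univ.filter fun x : G q => x⁻¹ * g * x = g) = Finset.univ :=
    Finset.filter_true_of_mem (fun x _ => CartanSupply.NormOne.conj_of_isScalar g x hs)
  have hcl : (Finset.univ.filter fun y : G q => ∃ x : G q, x⁻¹ * g * x = y) = {g} := by
    ext y
    simp only [Finset.mem_filter, Finset.mem_univ, true_and, Finset.mem_singleton]
    constructor
    · rintro ⟨x, hx⟩; rw [CartanSupply.NormOne.conj_of_isScalar g x hs] at hx; exact hx.symm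
    · rintro rfl; exact ⟨1, by simp⟩
  rw [hC, hcl, Finset.sum_singleton, Finset.card_univ, card_G_cast] at key
  apply mul_left_cancel₀ (card_torus_ne_zero (k := ℂ) hη)
  rw [key, card_torus_cast hη]; ring

/-- **PARABOLIC or SPLIT class**: `χ_{Ind ν}(g) = 0`. -/
theorem torusIndGen_of_hasRatEigenvalue (hη : ¬ HasRatEigenvalue eta) (θ : torusSubgroup eta →* ℂ) {g : G q}
    (hns : ¬ CartanDegree.IsScalarMat (g : Mat q)) (hr : HasRatEigenvalue (g : Mat q)) : (monRep (torusSubgroup eta) θ).character g = 0 := by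
  have key := frobenius_GL (torusSubgroup eta) θ g
  have hsum : ∑ y ∈ Finset.univ.filter (fun y : G q => ∃ x : G q, x⁻¹ * g * x = y), wt (torusSubgroup eta) θ y = 0 := by
    refine Finset.sum_eq_zero (fun y hy => ?_)
    obtain ⟨x, rfl⟩ := (Finset.mem_filter.1 hy).2
    refine wt_of_not_mem _ _ (fun hE => ?_)
    have hns' : ¬ CartanDegree.IsScalarMat ((x⁻¹ * g * x : G q) : Mat q) := by rwa [CartanSupply.NormOne.isScalarMat_conj]
    exact CartanSupply.NormOne.nonsplitTorus_types hη (mem_nonsplitTorus_iff.2 hE) hns' (by rwa [CartanSupply.NormOne.hasRatEigenvalue_conj])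
  rw [hsum, mul_zero] at key
  exact (mul_eq_zero.1 key).resolve_left (card_torus_ne_zero hη)

/-- **ELLIPTIC class of an element of `T_η` itself**: `χ_{Ind ν}(t) = ν(t) + ν(tr(t)·1 − t)` (`cl(t) ∩ T_η = {t, partner t}`, `q` odd). -/
theorem torusIndGen_torus (hq2 : q ≠ 2) (hη : ¬ HasRatEigenvalue eta) (θ : torusSubgroup eta →* ℂ) {t : G q}
    (htT : t ∈ torusSubgroup eta) (hns : ¬ CartanDegree.IsScalarMat (t : Mat q)) :
    (monRep (torusSubgroup eta) θ).character t = θ ⟨t, htT⟩ + θ ⟨partner t, partner_mem htT⟩ := by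
  have hg : ¬ HasRatEigenvalue (t : Mat q) := CartanSupply.NormOne.nonsplitTorus_types hη (mem_nonsplitTorus_iff.2 htT) hns
  set S := (nonsplitTorus eta).filter fun x => ∃ y : G q, y⁻¹ * t * y = x with hS
  have hScard : S.card = 2 := CartanSupply.NormOne.card_nonsplitTorus_conj_of_elliptic hq2 hη t hg
  have htS : t ∈ S := Finset.mem_filter.2 ⟨mem_nonsplitTorus_iff.2 htT, 1, by simp⟩
  have ht'S : partner t ∈ S := Finset.mem_filter.2 ⟨mem_nonsplitTorus_iff.2 (partner_mem htT), partner_conj hns ⟨1, by simp⟩⟩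
  have hne : partner t ≠ t := partner_ne hq2 hns
  have hSeq : S = {t, partner t} := by
    symm
    apply Finset.eq_of_subset_of_card_le
    · intro y hy
      rcases Finset.mem_insert.1 hy with rfl | hy
      · exact htS
      · rw [Finset.mem_singleton.1 hy]; exact ht'S
    · rw [hScard, Finset.card_pair hne.symm]
  have key := frobenius_GL (torusSubgroup eta) θ t
  rw [CartanSupply.NormOne.card_centralizer_of_not_hasRatEigenvalue t hg] at key
  have hsum : ∑ y ∈ Finset.univ.filter (fun y : G q => ∃ x : G q, x⁻¹ * t * x = y), wt (torusSubgroup eta) θ y =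
      wt (torusSubgroup eta) θ t + wt (torusSubgroup eta) θ (partner t) := by
    apply Finset.sum_eq_add_of_mem t (partner t) (Finset.mem_filter.2 ⟨Finset.mem_univ _, 1, by simp⟩)
      (Finset.mem_filter.2 ⟨Finset.mem_univ _, partner_conj hns ⟨1, by simp⟩⟩) hne.symm
    rintro c hc ⟨hce, hce'⟩
    refine wt_of_not_mem _ _ (fun hcE => ?_)
    have hcS : c ∈ S := Finset.mem_filter.2 ⟨mem_nonsplitTorus_iff.2 hcE, (Finset.mem_filter.1 hc).2⟩
    rw [hSeq, Finset.mem_insert, Finset.mem_singleton] at hcS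
    rcases hcS with h | h
    · exact hce h
    · exact hce' h
  rw [hsum, wt_of_mem _ _ htT, wt_of_mem _ _ (partner_mem htT)] at key
  have hcard : (((q - 1) * (q + 1) : ℕ) : ℂ) = ((q : ℂ) - 1) * ((q : ℂ) + 1) := by
    rw [Nat.cast_mul, Nat.cast_sub (Fact.out : q.Prime).one_lt.le, Nat.cast_one, Nat.cast_add, Nat.cast_one]
  rw [hcard] at key
  apply mul_left_cancel₀ (card_torus_ne_zero (k := ℂ) hη)
  rw [key, card_torus_cast hη]

/-- `ν(partner t) = ν(t)⁻¹` for a character `ν` of `T_η` trivial on the scalars (`partner t · t = det(t)·1`). -/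
theorem partner_eq_inv (θ : torusSubgroup eta →* ℂ) (hZ : ∀ x : torusSubgroup eta, CartanDegree.IsScalarMat ((x : G q) : Mat q) → θ x = 1)
    {t : G q} (htT : t ∈ torusSubgroup eta) : θ ⟨partner t, partner_mem htT⟩ = (θ ⟨t, htT⟩)⁻¹ := by
  have hts : CartanDegree.IsScalarMat (((partner t * t : G q)) : Mat q) := by
    rw [Units.val_mul, partner_coe, partner_mul]
    refine ⟨?_, ?_, ?_⟩ <;> simp [Matrix.smul_apply, Matrix.one_apply_ne]
  have h1 : θ ⟨partner t, partner_mem htT⟩ * θ ⟨t, htT⟩ = 1 := by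
    rw [← map_mul]; exact hZ _ hts
  have hne : θ ⟨t, htT⟩ ≠ 0 := fun h0 => by rw [h0, mul_zero] at h1; exact zero_ne_one h1
  exact eq_inv_of_mul_eq_one_left h1

omit [Fact q.Prime] in
/-- `1` is scalar. -/
theorem isScalarMat_one : CartanDegree.IsScalarMat (((1 : G q)) : Mat q) := by
  refine ⟨?_, ?_, ?_⟩ <;> simp [Matrix.one_apply_ne]

/-- `upperGL a a 0 = scalarGL a`. -/
theorem upperGL_self_zero (a : (ZMod q)ˣ) : upperGL a a 0 = Charext.scalarGL a := by
  apply Units.ext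
  rw [upperGL_coe, Charext.coe_scalarGL]
  ext i j
  fin_cases i <;> fin_cases j <;> simp [Matrix.one_apply_ne]

/-- `n(y) ∈ ZN`. -/
theorem upperUnip_mem_znSub (y : ZMod q) : upperUnip y ∈ znSub q := by
  rw [mem_znSub_iff, coe_upperUnip]; simp

/-- the discriminant of `(a b; 0 a)` vanishes. -/
theorem discr_upperGL_self (a : (ZMod q)ˣ) (b : ZMod q) :
    ((upperGL a a b : G q) : Mat q).trace ^ 2 - 4 * ((upperGL a a b : G q) : Mat q).det = 0 := by
  rw [(trace_det_upperGL a a b).1, (trace_det_upperGL a a b).2]; ring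

/-- sums over `ZN`, parametrised by `(a, b) ↦ (a b; 0 a)`. -/
theorem sum_znSub_eq (F : znSub q → ℂ) :
    ∑ h : znSub q, F h = ∑ p : (ZMod q)ˣ × ZMod q, F ⟨upperGL p.1 p.1 p.2, upperGL_mem_znSub p.1 p.2⟩ := by
  symm
  refine Fintype.sum_bijective (fun p : (ZMod q)ˣ × ZMod q => (⟨upperGL p.1 p.1 p.2, upperGL_mem_znSub p.1 p.2⟩ : znSub q))
    ⟨fun p p' h => zn_param_injective (Subtype.ext_iff.1 h), fun h => ?_⟩ _ _ (fun p => rfl)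
  obtain ⟨a, b, hab⟩ := exists_upperGL_of_mem_znSub h.2
  exact ⟨(a, b), Subtype.ext hab⟩

/-- the value of `znChar ψ` at `(a b; 0 a)`. -/
theorem znChar_upperGL (ψ : AddChar (ZMod q) ℂ) (a : (ZMod q)ˣ) (b : ZMod q) :
    znChar ψ ⟨upperGL a a b, upperGL_mem_znSub a b⟩ = ψ (b * (a : ZMod q)⁻¹) := by
  have h := wt_zn_upperGL ψ a b
  rwa [wt_of_mem _ _ (upperGL_mem_znSub a b)] at h

/-! ### §O.2 The faithful character `θ₁` of the cyclic group `T_η` and the family `ν_j = θ₁^j` -/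

/-- a primitive `n`-th root of unity in `ℂˣ`. -/
theorem exists_primitiveRoot_units (n : ℕ) (hn : n ≠ 0) : ∃ z : ℂˣ, IsPrimitiveRoot z n := by
  have hr : IsPrimitiveRoot (Complex.exp (2 * Real.pi * Complex.I / n)) n := Complex.isPrimitiveRoot_exp n hn
  have hu : IsUnit (Complex.exp (2 * Real.pi * Complex.I / n)) := hr.isUnit hn
  exact ⟨hu.unit, IsPrimitiveRoot.coe_units_iff.1 (by rw [IsUnit.unit_spec]; exact hr)⟩

/-- a chosen primitive `|T_η|`-th root of unity. -/
def rootT (eta : Mat q) : ℂˣ := Classical.choose (exists_primitiveRoot_units (Fintype.card (torusSubgroup eta)) Fintype.card_ne_zero)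

/-- `rootT eta` is a primitive `|T_η|`-th root of unity. -/
theorem rootT_spec (eta : Mat q) : IsPrimitiveRoot (rootT eta) (Fintype.card (torusSubgroup eta)) :=
  Classical.choose_spec (exists_primitiveRoot_units (Fintype.card (torusSubgroup eta)) Fintype.card_ne_zero)

/-- the chosen generator of `T_η` has order `|T_η|`. -/
theorem orderOf_gen (hη : ¬ HasRatEigenvalue eta) : orderOf (gen (torusSubgroup_isCyclic hη)) = Fintype.card (torusSubgroup eta) := by
  rw [orderOf_eq_card_of_forall_mem_zpowers (gen_spec (torusSubgroup_isCyclic hη)), Nat.card_eq_fintype_card]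

/-- **THE FAITHFUL CHARACTER** `θ₁ : T_η → ℂˣ`: the chosen generator goes to the chosen primitive `|T_η|`-th root of unity. -/
def faith (hη : ¬ HasRatEigenvalue eta) : torusSubgroup eta →* ℂˣ :=
  monoidHomOfForallMemZpowers (gen_spec (torusSubgroup_isCyclic hη))
    (by rw [← (rootT_spec eta).eq_orderOf, orderOf_gen hη])

/-- `θ₁(gen) = rootT`. -/
theorem faith_gen (hη : ¬ HasRatEigenvalue eta) : faith hη (gen (torusSubgroup_isCyclic hη)) = rootT eta :=
  monoidHomOfForallMemZpowers_apply_gen _ _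

/-- faithfulness: `θ₁(t) = 1 ↔ t = 1`. -/
theorem faith_eq_one_iff (hη : ¬ HasRatEigenvalue eta) (t : torusSubgroup eta) : faith hη t = 1 ↔ t = 1 := by
  obtain ⟨k, rfl⟩ := Subgroup.mem_zpowers_iff.1 (gen_spec (torusSubgroup_isCyclic hη) t)
  rw [map_zpow, faith_gen, (rootT_spec eta).zpow_eq_one_iff_dvd, ← orderOf_gen hη, ← orderOf_dvd_iff_zpow_eq_one]

/-- the family `ν_j := θ₁^j` of `ℂ`-valued characters of `T_η`. -/
def chi (hη : ¬ HasRatEigenvalue eta) (j : ℕ) : torusSubgroup eta →* ℂ := (Units.coeHom ℂ).comp (faith hη ^ j)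

/-- `ν_j(t) = θ₁(t)^j`. -/
theorem chi_apply (hη : ¬ HasRatEigenvalue eta) (j : ℕ) (t : torusSubgroup eta) : chi hη j t = ((faith hη t : ℂˣ) : ℂ) ^ j := by
  rw [chi, MonoidHom.comp_apply, MonoidHom.pow_apply, Units.coeHom_apply, Units.val_pow_eq_pow_val]

/-- `ν_j` is trivial on the scalars when `q − 1 ∣ j`. -/
theorem chi_scalar (hη : ¬ HasRatEigenvalue eta) (j' : ℕ) (x : torusSubgroup eta) (hs : CartanDegree.IsScalarMat ((x : G q) : Mat q)) :
    chi hη ((q - 1) * j') x = 1 := by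
  have hx : x ^ (q - 1) = 1 := Subtype.ext (by rw [Subgroup.coe_pow, Subgroup.coe_one]; exact pow_card_sub_one_of_isScalar hs)
  rw [chi_apply, pow_mul, ← Units.val_pow_eq_pow_val, ← map_pow, hx, map_one, Units.val_one, one_pow]

/-- **orthogonality on `T_η`**: `Σ_{j < |T_η|} ν_j(t⁻¹) = |T_η|·[t = 1]`. -/
theorem sum_chi_inv (hη : ¬ HasRatEigenvalue eta) (t : torusSubgroup eta) :
    ∑ j ∈ Finset.range (Fintype.card (torusSubgroup eta)), chi hη j t⁻¹ =
      if t = 1 then (Fintype.card (torusSubgroup eta) : ℂ) else 0 := by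
  simp_rw [chi_apply]
  by_cases ht : t = 1
  · rw [if_pos ht, ht, inv_one, map_one, Units.val_one]
    simp
  · rw [if_neg ht]
    have hx1 : ((faith hη t⁻¹ : ℂˣ) : ℂ) ≠ 1 := by
      intro h
      apply ht
      rw [← inv_eq_one, ← faith_eq_one_iff hη]
      exact Units.val_eq_one.1 h
    have hxN : ((faith hη t⁻¹ : ℂˣ) : ℂ) ^ Fintype.card (torusSubgroup eta) = 1 := by
      rw [← Units.val_pow_eq_pow_val, ← map_pow, pow_card_eq_one, map_one, Units.val_one]
    rw [geom_sum_eq hx1, hxN, sub_self, zero_div]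

/-! ### §O.3 The two orthogonality counts: `Σ_j dim Hom_{T_η}(ν_j, W) = dim W = Σ_j dim Hom_{ZN}(ψ_j, W)` -/

variable {W : Type} [AddCommGroup W] [Module ℂ W] [Module.Finite ℂ W] (ρ : Representation ℂ (G q) W)

/-- `Σ_{j < |T_η|} dim Hom_{T_η}(ν_j, W|_{T_η}) = dim W` (every representation). -/
theorem sum_hom_torus_eq (hη : ¬ HasRatEigenvalue eta) :
    ∑ j ∈ Finset.range (Fintype.card (torusSubgroup eta)),
        Module.finrank ℂ (IntertwiningMap (lineRep (chi hη j)) (res ρ (torusSubgroup eta))) = Module.finrank ℂ W := by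
  have hN : (Fintype.card (torusSubgroup eta) : ℂ) ≠ 0 := by exact_mod_cast Fintype.card_ne_zero
  have key : ∑ j ∈ Finset.range (Fintype.card (torusSubgroup eta)),
      (Fintype.card (torusSubgroup eta) : ℂ) * Module.finrank ℂ (IntertwiningMap (lineRep (chi hη j)) (res ρ (torusSubgroup eta))) =
      (Fintype.card (torusSubgroup eta) : ℂ) * Module.finrank ℂ W := by
    simp_rw [← sum_sub_character_mul]
    rw [Finset.sum_comm]
    simp_rw [← Finset.mul_sum, sum_chi_inv hη, mul_ite, mul_zero]
    rw [Finset.sum_ite_eq' Finset.univ (1 : torusSubgroup eta)]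
    simp only [Finset.mem_univ, if_true]
    rw [OneMemClass.coe_one, Representation.char_one, mul_comm]
  rw [← Finset.mul_sum] at key
  exact_mod_cast mul_left_cancel₀ hN key

/-- `dim Hom_{T_η}(1, W|_{T_η}) ≥ 1` when `W` has a non-zero `T_η`-fixed vector. -/
theorem hom_torus_zero_pos (hη : ¬ HasRatEigenvalue eta) {u : W} (hu0 : u ≠ 0) (hu : ∀ t ∈ torusSubgroup eta, ρ t u = u) :
    0 < Module.finrank ℂ (IntertwiningMap (lineRep (chi hη 0)) (res ρ (torusSubgroup eta))) :=
  finrank_hom_pos _ _ hu0 fun t => by rw [res_apply, chi_apply, pow_zero, one_smul]; exact hu t t.2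

/-- `Σ_{j ∈ 𝔽_q} dim Hom_{ZN}(ψ_j, W|_{ZN}) = dim W` when the scalars act trivially on `W`. -/
theorem sum_hom_zn_eq (hZ : ∀ (a : (ZMod q)ˣ) (w : W), ρ (Charext.scalarGL a) w = w) :
    ∑ j : ZMod q, Module.finrank ℂ (IntertwiningMap (lineRep (znChar ((ψq (q := q)).mulShift j))) (res ρ (znSub q))) =
      Module.finrank ℂ W := by
  have hq0 : (q : ℂ) ≠ 0 := Nat.cast_ne_zero.2 (Fact.out : q.Prime).ne_zero
  have hq1 : ((q : ℂ) - 1) ≠ 0 := by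
    rw [sub_ne_zero]; exact_mod_cast (Fact.out : q.Prime).one_lt.ne'
  have hZN : (Fintype.card (znSub q) : ℂ) = (q : ℂ) * ((q : ℂ) - 1) := by
    rw [← Nat.card_eq_fintype_card]; exact card_znSub_cast
  have hsc : ∀ a : (ZMod q)ˣ, ρ.character (Charext.scalarGL a) = Module.finrank ℂ W := by
    intro a
    have h1 : ρ (Charext.scalarGL a) = 1 := LinearMap.ext (hZ a)
    rw [Representation.character, h1, LinearMap.trace_one]
  have key : ∑ j : ZMod q, (Fintype.card (znSub q) : ℂ) *
      Module.finrank ℂ (IntertwiningMap (lineRep (znChar ((ψq (q := q)).mulShift j))) (res ρ (znSub q))) =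
      (q : ℂ) * ((q : ℂ) - 1) * Module.finrank ℂ W := by
    simp_rw [← sum_sub_character_mul, sum_znSub_eq]
    rw [Finset.sum_comm]
    have hinner : ∀ p : (ZMod q)ˣ × ZMod q,
        ∑ j : ZMod q, ρ.character ((⟨upperGL p.1 p.1 p.2, upperGL_mem_znSub p.1 p.2⟩ : znSub q) : G q) *
          znChar ((ψq (q := q)).mulShift j) (⟨upperGL p.1 p.1 p.2, upperGL_mem_znSub p.1 p.2⟩ : znSub q)⁻¹ =
        if p.2 = 0 then (q : ℂ) * Module.finrank ℂ W else 0 := by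
      rintro ⟨a, b⟩
      have e1 : ∀ j : ZMod q, znChar ((ψq (q := q)).mulShift j) (⟨upperGL a a b, upperGL_mem_znSub a b⟩ : znSub q)⁻¹ =
          ψq (-(j * (b * (a : ZMod q)⁻¹))) := by
        intro j; rw [map_inv, znChar_upperGL, AddChar.mulShift_apply, AddChar.map_neg_eq_inv]
      have hs : ∑ j : ZMod q, ψq (-(j * (b * (a : ZMod q)⁻¹))) = if b = 0 then (q : ℂ) else 0 := by
        rw [show (∑ j : ZMod q, ψq (-(j * (b * (a : ZMod q)⁻¹)))) = ∑ j : ZMod q, ψq (j * (b * (a : ZMod q)⁻¹)) from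
          Fintype.sum_equiv (Equiv.neg (ZMod q)) _ _ (fun j => by rw [Equiv.neg_apply, neg_mul]), sum_ψq_mul]
        by_cases hb : b = 0
        · rw [if_pos hb, hb, zero_mul, if_pos rfl]
        · rw [if_neg hb, if_neg (mul_ne_zero hb (inv_ne_zero a.ne_zero))]
      rw [Fintype.sum_congr _ _ (fun j => by rw [e1]), ← Finset.mul_sum, hs]
      by_cases hb : b = 0
      · subst hb
        rw [if_pos rfl, if_pos rfl, show ((⟨upperGL a a 0, upperGL_mem_znSub a 0⟩ : znSub q) : G q) = upperGL a a 0 from rfl,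
          upperGL_self_zero a, hsc]
        ring
      · rw [if_neg hb, if_neg hb, mul_zero]
    simp_rw [hinner]
    rw [Fintype.sum_prod_type]
    simp_rw [Finset.sum_ite_eq' Finset.univ (0 : ZMod q)]
    simp only [Finset.mem_univ, if_true, Finset.sum_const, Finset.card_univ, ZMod.card_units q, nsmul_eq_mul]
    rw [Nat.cast_sub (Fact.out : q.Prime).one_lt.le, Nat.cast_one]; ring
  rw [← Finset.mul_sum, hZN] at key
  exact_mod_cast mul_left_cancel₀ (mul_ne_zero hq0 hq1) key

omit [Module.Finite ℂ W] in
/-- `Hom_{ZN}(ψ_0, W|_{ZN}) = 0` when `W` has no non-zero `N`-fixed vector. -/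
theorem hom_zn_zero (hcusp : ∀ w : W, (∀ y : ZMod q, ρ (upperUnip y) w = w) → w = 0) :
    Module.finrank ℂ (IntertwiningMap (lineRep (znChar ((ψq (q := q)).mulShift 0))) (res ρ (znSub q))) = 0 := by
  refine finrank_hom_eq_zero _ _ fun v hv => hcusp v fun y => ?_
  have h := hv ⟨upperUnip y, upperUnip_mem_znSub y⟩
  rwa [res_apply, znChar_apply, znWeight_apply, AddChar.mulShift_apply, zero_mul, AddChar.map_zero_eq_one, one_smul] at h


end Cusprow

end Summit.BirchSwinnertonDyer.BirchSwinnertonDyer.Theorems.CartanDoubleCoset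

end
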